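import Mathlib
import Summits.NavierStokesRegularity.NavierStokesRegularity.Theses.ExactWindowRungThree
import Summits.NavierStokesRegularity.NavierStokesRegularity.Theses.PicardRadiiRungThree
import Summits.NavierStokesRegularity.NavierStokesRegularity.Theorems.TrappingWindowRungThreeTailEnvelopes
import HarnessLib

/-!
# `TailEnvelopes` for the sibling window routes `ExactWindowRungThree` and `PicardRadiiRungThree`
  (shared item stmt-NavierStokesRegularity-21748, crux K2)

The three TL-M3 window routes `TrappingWindowRungThree`, `ExactWindowRungThree` and
`PicardRadiiRungThree` file the analytic tail envelopes K2 as ONE shared item with byte-identical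
statement text; the proof `trappingWindowRungThree_tailEnvelopes_proof` therefore proves the sibling
decls by definitional unfolding. This file records the two by-name corollaries so that each sibling
route has a theorem whose type is literally its own `TailEnvelopes` decl.

HONEST FRAMING: MODEL lattice statement (rung TL-M3 of the Tao ladder); nothing here is a statement about
the Navier–Stokes equations; NS regularity is NOT proved by anything in this file.
-/

noncomputable section

-- the sub-problem namespace repeats the summit name by design (D-0017)
set_option linter.dupNamespace false

namespace Summit.NavierStokesRegularity.NavierStokesRegularity.Theorems

/-- **K2 for route `ExactWindowRungThree`** (shared item stmt-NavierStokesRegularity-21748): the sibling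
route's `TailEnvelopes` decl is byte-identical to `TrappingWindowRungThree.TailEnvelopes`, so the proof
transfers by definitional unfolding. MODEL lattice statement; nothing about Navier–Stokes is concluded.
[cite: Tao2016AveragedNS, §4 Lemma 4.1 (4.5), (4.8)–(4.10) with (4.3); route ExactWindowRungThree, item K2] -/
theorem exactWindowRungThree_tailEnvelopes_proof :
    Summit.NavierStokesRegularity.NavierStokesRegularity.Theses.ExactWindowRungThree.TailEnvelopes :=
  trappingWindowRungThree_tailEnvelopes_proof

/-- **K2 for route `PicardRadiiRungThree`** (shared item stmt-NavierStokesRegularity-21748): the sibling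
route's `TailEnvelopes` decl is byte-identical to `TrappingWindowRungThree.TailEnvelopes`, so the proof
transfers by definitional unfolding. MODEL lattice statement; nothing about Navier–Stokes is concluded.
[cite: Tao2016AveragedNS, §4 Lemma 4.1 (4.5), (4.8)–(4.10) with (4.3); route PicardRadiiRungThree, item K2] -/
theorem picardRadiiRungThree_tailEnvelopes_proof :
    Summit.NavierStokesRegularity.NavierStokesRegularity.Theses.PicardRadiiRungThree.TailEnvelopes :=
  trappingWindowRungThree_tailEnvelopes_proof

end Summit.NavierStokesRegularity.NavierStokesRegularity.Theorems

end
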